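import Mathlib.Analysis.Convolution
import Mathlib.Analysis.SpecialFunctions.JapaneseBracket
import Literature.Analysis.FluidPDE.NormalisedPressureDuality
import Literature.Analysis.FluidPDE.NormalisedPressureDischarge
import HarnessLib

/-!
# The normalised pressure of a compactly supported smooth field

Analysis/FluidPDE support file (serves the discharge of the barrier fact
`Literature.Barriers.NavierStokesRegularity.NSISwitching`, Scheffer 1985, Lemma 2.3 /
Ożański 2017, §2, whose velocity fields have `C^∞` slices supported in a fixed compact set).

For a slice `w ∈ C_c^∞(ℝ³; ℝ³)` the normalised pressure `p̃[w] = -Δ⁻¹∂ᵢ∂ⱼ(wᵢwⱼ)` of the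
accepted `NormalisedPressure.lean` (Tao's `p̃`; for such `w` it is Scheffer's (1.4) /
Ożański's (1.1) `Σ ∂ᵢ∂ⱼΨ ∗ (wᵢwⱼ)`, cf. `normalisedPressure_eq_pressurePotential`) enjoys:

* `contDiff_normalisedPressure_of_hasCompactSupport`, `laplacian_normalisedPressure_of_hasCompactSupport`
  — `p̃[w] ∈ C²` and `Δp̃[w] = -∂ᵢ∂ⱼ(wᵢwⱼ)` (from `PressureRepresentation`);
* `integral_normalisedPressure_mul_laplacian` — the **weak pressure Poisson equation**
  `-∫ p̃[w] Δψ = ∫ D²ψ(w, w)` for every `ψ ∈ C²_c` (the form of the tree's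
  `Literature.Barriers.NavierStokesRegularity.IsPressureOf`);
* `exists_abs_normalisedPressure_le_of_hasCompactSupport` — the **decay**
  `|p̃[w](x)| ≤ C (1 + |x|)⁻³` (off the support the principal value is an honest integral
  against the kernel `O(|x-y|⁻³)`);
* `memLp_normalisedPressure_of_hasCompactSupport` — hence `p̃[w] ∈ L^r` for every
  `1 < r < ∞`, in particular `p̃[w] ∈ L^{3/2}` (`memLp_normalisedPressure_three_halves`), the
  integrability class of `IsPressureOf` (Ożański 2020, Def. 1.1);
* `continuousOn_normalisedPressure_slice` — **joint continuity** of
  `(t, x) ↦ p̃[u(t)](x)` on `S × ℝ³` for a velocity field `u` jointly smooth on `S × ℝ³` whose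
  slices are supported in a fixed compact set (the near potential is a convolution of the
  `L¹_loc` Newtonian kernel with the jointly continuous, uniformly compactly supported source
  `∂ᵢ∂ⱼ(uᵢuⱼ)`, Mathlib's `continuousOn_convolution_right_with_param`; the far potential vanishes
  at a large cutoff scale).

## Mathlib / tree search

Mathlib: `continuousOn_convolution_right_with_param`, `convolution_mul`, `integrable_one_add_norm`
(`∫ (1+|x|)^{-r} < ∞` for `r > dim`), `integrable_norm_rpow_iff`, `MemLp.of_le` (all used).
Tree: `normalisedPressure_eq_pressurePotential'`, `contDiff_pressurePotential`,
`laplacian_pressurePotential`, `pressurePotential_eq_scale`, `fderiv2_newtonFar_eq_zero`,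
`integral_mul_pressureSource` (`PressureRepresentation`); `abs_normalisedPressure_sub_truncated_le`,
`abs_truncatedPressureIntegral_le_energy` (`NormalisedPressureDuality`);
`truncatedPressureIntegral_sub` (`NormalisedPressurePV`); `integral_inner_laplacian_comm`
(`ClassicalSolutionCalculus`); `IsSmoothSpaceTimeOn.pressureSource` (`NormalisedPressureDischarge`).

## References

* W. S. Ożański, *On weak solutions to the Navier–Stokes inequality with internal
  singularities*, arXiv:1709.00602 (2017), §1 (1.1), §2. [`Ozanski2017NSISingular`]
* W. S. Ożański, Comm. Math. Phys. 374 (2020), Def. 1.1 and the paragraph after Def. 2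
  (`p ∈ L^{5/3}`; all terms of the local energy inequality are well defined). [`Ozanski2019NSI`]
* V. Scheffer, Comm. Math. Phys. 101 (1985), (1.4). [`Scheffer1985`]
* D. Gilbarg, N. Trudinger, *Elliptic PDE of second order*, Lemma 4.2. [`GilbargTrudinger2001`]
-/

noncomputable section

open MeasureTheory Set Filter Metric Topology Function
open scoped ENNReal RealInnerProductSpace ContDiff Laplacian Convolution

namespace Literature.Analysis.FluidPDE

-- nested operator types `ℝ³ →L[ℝ] ℝ³ →L[ℝ] ℝ`
set_option maxSynthPendingDepth 3

/-! ### Regularity, Poisson equation, weak Poisson equation -/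

section CompactSupport

variable {w : (EuclideanSpace ℝ (Fin 3)) → (EuclideanSpace ℝ (Fin 3))}

/-- `|w|² ∈ L¹` for a continuous compactly supported field. [folklore] -/
theorem integrable_norm_sq_of_hasCompactSupport (hw : Continuous w) (hwc : HasCompactSupport w) :
    Integrable (fun y => ‖w y‖ ^ 2) (volume : Measure (EuclideanSpace ℝ (Fin 3))) := by
  have h2 : HasCompactSupport fun y => ‖w y‖ ^ 2 :=
    hwc.norm.comp_left (g := fun t : ℝ => t ^ 2) (by norm_num)
  exact (hw.norm.pow 2).integrable_of_hasCompactSupport h2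

/-- `∫ ‖w‖ₑ² < ∞` for a continuous compactly supported field. [folklore] -/
theorem lintegral_enorm_sq_lt_top_of_hasCompactSupport (hw : Continuous w)
    (hwc : HasCompactSupport w) : (∫⁻ x, ‖w x‖ₑ ^ 2) < ⊤ := by
  have h := (integrable_norm_sq_of_hasCompactSupport hw hwc).hasFiniteIntegral
  rw [hasFiniteIntegral_iff_enorm] at h
  refine lt_of_le_of_lt (le_of_eq (lintegral_congr fun x => ?_)) h
  rw [Real.enorm_eq_ofReal (sq_nonneg _), ENNReal.ofReal_pow (norm_nonneg _), ofReal_norm]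

/-- For `w ∈ C_c^∞` the normalised pressure is the pressure potential `Q[w]` of
`PressureRepresentation` (the principal-value formula evaluates to it).
[cite: Ozanski2017NSISingular, §1 (1.1)] -/
theorem normalisedPressure_eq_pressurePotential_of_hasCompactSupport (hw : ContDiff ℝ ∞ w)
    (hwc : HasCompactSupport w) : normalisedPressure w = pressurePotential w :=
  normalisedPressure_eq_pressurePotential' (contDiff_infty.1 hw 2)
    (integrable_norm_sq_of_hasCompactSupport hw.continuous hwc)

/-- **`p̃[w] ∈ C²`** for `w ∈ C_c^∞(ℝ³; ℝ³)`. [cite: GilbargTrudinger2001, Lemma 4.2] -/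
theorem contDiff_normalisedPressure_of_hasCompactSupport (hw : ContDiff ℝ ∞ w)
    (hwc : HasCompactSupport w) : ContDiff ℝ 2 (normalisedPressure w) := by
  rw [normalisedPressure_eq_pressurePotential_of_hasCompactSupport hw hwc]
  exact contDiff_pressurePotential (contDiff_infty.1 hw 4)
    (integrable_norm_sq_of_hasCompactSupport hw.continuous hwc)

/-- `p̃[w]` is continuous for `w ∈ C_c^∞`. [folklore] -/
theorem continuous_normalisedPressure_of_hasCompactSupport (hw : ContDiff ℝ ∞ w)
    (hwc : HasCompactSupport w) : Continuous (normalisedPressure w) :=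
  (contDiff_normalisedPressure_of_hasCompactSupport hw hwc).continuous

/-- **The pressure Poisson equation** `Δ p̃[w] = -∂ᵢ∂ⱼ(wᵢwⱼ)` for `w ∈ C_c^∞(ℝ³; ℝ³)`
(Scheffer 1985, (1.12)–(1.13): `Δp = -Σ ∂ᵢuⱼ ∂ⱼuᵢ`). [cite: GilbargTrudinger2001, Lemma 4.2] -/
theorem laplacian_normalisedPressure_of_hasCompactSupport (hw : ContDiff ℝ ∞ w)
    (hwc : HasCompactSupport w) (x : (EuclideanSpace ℝ (Fin 3))) :
    Δ (normalisedPressure w) x = -pressureSource w x := by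
  rw [normalisedPressure_eq_pressurePotential_of_hasCompactSupport hw hwc]
  exact laplacian_pressurePotential (contDiff_infty.1 hw 4)
    (integrable_norm_sq_of_hasCompactSupport hw.continuous hwc) x

/-- **The weak pressure Poisson equation**: for `w ∈ C_c^∞(ℝ³; ℝ³)` and every `ψ ∈ C²_c(ℝ³)`,
`-∫ p̃[w] Δψ = ∫ D²ψ(w, w)` (Green's second identity without boundary, then the double
integration by parts `∫ ψ ∂ᵢ∂ⱼ(wᵢwⱼ) = ∫ ∂ᵢ∂ⱼψ wᵢwⱼ`). This is the characterisation of "the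
pressure function corresponding to `w`" used by the tree's `IsPressureOf`
(Ożański 2020, (1.1)). [cite: Ozanski2019NSI, Def. 1.1 (1.1)] -/
theorem integral_normalisedPressure_mul_laplacian (hw : ContDiff ℝ ∞ w)
    (hwc : HasCompactSupport w) {ψ : (EuclideanSpace ℝ (Fin 3)) → ℝ} (hψ : ContDiff ℝ 2 ψ) (hψc : HasCompactSupport ψ) :
    -∫ x, normalisedPressure w x * Δ ψ x = ∫ x, fderiv ℝ (fderiv ℝ ψ) x (w x) (w x) := by
  have hp2 := contDiff_normalisedPressure_of_hasCompactSupport hw hwc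
  have hcomm := integral_inner_laplacian_comm (F' := ℝ) hp2 hψ hψc
  have e1 : ∫ x, ⟪(Δ (normalisedPressure w)) x, ψ x⟫ =
      -∫ x, ψ x * pressureSource w x := by
    rw [← integral_neg]
    refine integral_congr_ae (Eventually.of_forall fun x => ?_)
    simp only [RCLike.inner_apply, conj_trivial]
    rw [laplacian_normalisedPressure_of_hasCompactSupport hw hwc x]
    ring
  have e2 : ∫ x, ⟪normalisedPressure w x, (Δ ψ) x⟫ = ∫ x, normalisedPressure w x * Δ ψ x :=
    integral_congr_ae (Eventually.of_forall fun x => by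
      simp only [RCLike.inner_apply, conj_trivial]; ring)
  rw [← e2, ← hcomm, e1, neg_neg, integral_mul_pressureSource hψ hψc (contDiff_infty.1 hw 2)]

/-! ### Decay and integrability -/

/-- **Off the support the normalised pressure is the far-field integral**: if `w` vanishes on
the closed ball `B̄(x, r)`, `r ≥ 1`, then `p̃[w](x) = ∫_{|x-y|>r} K(x-y)(w y) dy`. [folklore] -/
theorem normalisedPressure_eq_truncated_of_vanish (hw : ContDiff ℝ ∞ w) (hwc : HasCompactSupport w)
    {x : (EuclideanSpace ℝ (Fin 3))} {r : ℝ} (hr : 1 ≤ r) (h0 : ∀ y ∈ closedBall x r, w y = 0) :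
    normalisedPressure w x = truncatedPressureIntegral w x r := by
  have hw1 : ContDiff ℝ 1 w := contDiff_infty.1 hw 1
  have hE := lintegral_enorm_sq_lt_top_of_hasCompactSupport hw.continuous hwc
  have hL2 := integrable_norm_sq_of_hasCompactSupport hw.continuous hwc
  have h01 : ∀ y ∈ closedBall x 1, w y = 0 := fun y hy =>
    h0 y (closedBall_subset_closedBall hr hy)
  have hx0 : w x = 0 := h01 x (mem_closedBall_self zero_le_one)
  have hM₀ : ∀ y ∈ closedBall x 1, ‖w y‖ ≤ 0 := fun y hy => by rw [h01 y hy, norm_zero]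
  have hM₁ : ∀ y ∈ closedBall x 1, ‖w y - w x‖ ≤ 0 * ‖y - x‖ := fun y hy => by
    rw [h01 y hy, hx0, sub_zero, norm_zero, zero_mul]
  -- `p̃(x) = T₁(x)`
  have h1 := abs_normalisedPressure_sub_truncated_le hw1 hE hM₀ hM₁ le_rfl one_pos le_rfl
  have h1' : |normalisedPressure w x - (-‖w x‖ ^ 2 / 3 + truncatedPressureIntegral w x 1)| ≤ 0 := by
    simpa only [mul_zero, zero_mul] using h1
  rw [hx0, norm_zero, zero_pow two_ne_zero, neg_zero, zero_div, zero_add] at h1'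
  have hT1 : normalisedPressure w x = truncatedPressureIntegral w x 1 :=
    sub_eq_zero.1 (abs_nonpos_iff.1 h1')
  rw [hT1]
  -- `T₁(x) = T_r(x)`: the shell integrand vanishes
  rcases eq_or_lt_of_le hr with rfl | hlt
  · rfl
  have hsub := truncatedPressureIntegral_sub hw.continuous hL2 x one_pos hlt
  have hshell : ∫ y in closedBall x r \ closedBall x 1, pressureKernel (x - y) (w y) = 0 :=
    setIntegral_eq_zero_of_forall_eq_zero fun y hy => by
      rw [h0 y hy.1, pressureKernel_zero_right]
  linarith

/-- **Decay of the normalised pressure of a compactly supported field**: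
`|p̃[w](x)| ≤ C (1 + |x|)⁻³` for all `x`, for `w ∈ C_c^∞(ℝ³; ℝ³)` (bounded on a large ball by
continuity; outside, an honest integral against `|K(x-y)(w y)| ≤ |w(y)|²/(2π|x-y|³)` with
`|x - y| ≥ |x|/2`; Ożański 2017, §1: "`p ∈ L^{5/3}`"). [cite: Ozanski2017NSISingular, §1] -/
theorem exists_abs_normalisedPressure_le_of_hasCompactSupport (hw : ContDiff ℝ ∞ w)
    (hwc : HasCompactSupport w) :
    ∃ C : ℝ, 0 ≤ C ∧ ∀ x, |normalisedPressure w x| ≤ C * (1 + ‖x‖) ^ (-(3 : ℝ)) := by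
  obtain ⟨ρ, hρ0, hρ⟩ : ∃ ρ : ℝ, 0 < ρ ∧ ∀ y, w y ≠ 0 → ‖y‖ ≤ ρ := by
    obtain ⟨R, hR0, hR⟩ := hwc.isCompact.isBounded.exists_pos_norm_le
    exact ⟨R, hR0, fun y hy => hR y (subset_tsupport _ (mem_support.2 hy))⟩
  have hL2 := integrable_norm_sq_of_hasCompactSupport hw.continuous hwc
  obtain ⟨E₀, hE₀⟩ : ∃ E₀ : ℝ, E₀ = ∫ y, ‖w y‖ ^ 2 := ⟨_, rfl⟩
  have hE₀0 : 0 ≤ E₀ := by rw [hE₀]; exact integral_nonneg fun y => by positivity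
  -- bound on the large ball of radius `R₀ = 2ρ + 2`
  have hR₀ : (0 : ℝ) < 2 * ρ + 2 := by positivity
  obtain ⟨M, hM⟩ := (isCompact_closedBall (0 : (EuclideanSpace ℝ (Fin 3))) (2 * ρ + 2)).exists_bound_of_continuousOn
    (continuous_normalisedPressure_of_hasCompactSupport hw hwc).continuousOn
  have hM0 : 0 ≤ M := (norm_nonneg _).trans (hM 0 (mem_closedBall_self hR₀.le))
  -- decay outside the large ball
  have hfar : ∀ x : (EuclideanSpace ℝ (Fin 3)), 2 * ρ + 2 ≤ ‖x‖ →
      |normalisedPressure w x| ≤ 4 * E₀ / (Real.pi * ‖x‖ ^ 3) := by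
    intro x hx
    have hxpos : 0 < ‖x‖ := lt_of_lt_of_le hR₀ hx
    obtain ⟨r, hr⟩ : ∃ r : ℝ, r = ‖x‖ / 2 := ⟨_, rfl⟩
    have hrpos : 0 < r := by rw [hr]; positivity
    have hr1 : 1 ≤ r := by rw [hr]; linarith
    have hvan : ∀ y ∈ closedBall x r, w y = 0 := by
      intro y hy
      by_contra hne
      have h1 : ‖y‖ ≤ ρ := hρ y hne
      rw [mem_closedBall, dist_eq_norm] at hy
      have h2 : ‖x‖ ≤ ‖y - x‖ + ‖y‖ := by
        calc ‖x‖ = ‖y - (y - x)‖ := by rw [sub_sub_cancel]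
          _ ≤ ‖y‖ + ‖y - x‖ := norm_sub_le _ _
          _ = ‖y - x‖ + ‖y‖ := add_comm _ _
      rw [hr] at hy
      linarith
    rw [normalisedPressure_eq_truncated_of_vanish hw hwc hr1 hvan]
    have h3 := abs_truncatedPressureIntegral_le_energy hw.continuous hL2 x hrpos
    have h4 : (∫ y, ‖w y‖ ^ 2) / (2 * Real.pi * r ^ 3) = 4 * E₀ / (Real.pi * ‖x‖ ^ 3) := by
      rw [hr, ← hE₀]
      field_simp
      ring
    rwa [h4] at h3
  -- assemble
  refine ⟨max (M * (1 + (2 * ρ + 2)) ^ 3) (32 * E₀ / Real.pi), ?_, fun x => ?_⟩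
  · exact le_max_of_le_left (by positivity)
  have h1x : 0 < 1 + ‖x‖ := by positivity
  rw [Real.rpow_neg h1x.le, show (3 : ℝ) = ((3 : ℕ) : ℝ) by norm_num, Real.rpow_natCast]
  rw [← div_eq_mul_inv, le_div_iff₀ (by positivity)]
  by_cases hx : ‖x‖ ≤ 2 * ρ + 2
  · have h1 : |normalisedPressure w x| ≤ M := by
      have := hM x (mem_closedBall_zero_iff.2 hx)
      rwa [Real.norm_eq_abs] at this
    calc |normalisedPressure w x| * (1 + ‖x‖) ^ 3 ≤ M * (1 + (2 * ρ + 2)) ^ 3 := by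
          gcongr
      _ ≤ max (M * (1 + (2 * ρ + 2)) ^ 3) (32 * E₀ / Real.pi) := le_max_left _ _
  · have hx' : 2 * ρ + 2 < ‖x‖ := not_le.1 hx
    have hxpos : 0 < ‖x‖ := hR₀.trans hx'
    have h2 : 1 + ‖x‖ ≤ 2 * ‖x‖ := by linarith
    have h3 : (1 + ‖x‖) ^ 3 ≤ 8 * ‖x‖ ^ 3 := by
      have h2' : 0 ≤ 1 + ‖x‖ := h1x.le
      calc (1 + ‖x‖) ^ 3 ≤ (2 * ‖x‖) ^ 3 := pow_le_pow_left₀ h2' h2 3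
        _ = 8 * ‖x‖ ^ 3 := by ring
    have h4 : 0 ≤ 4 * E₀ / (Real.pi * ‖x‖ ^ 3) := by positivity
    have h5 : 4 * E₀ / (Real.pi * ‖x‖ ^ 3) * (8 * ‖x‖ ^ 3) = 32 * E₀ / Real.pi := by
      have hx3 : ‖x‖ ^ 3 ≠ 0 := by positivity
      rw [div_mul_eq_mul_div, mul_comm Real.pi, ← div_div, show 4 * E₀ * (8 * ‖x‖ ^ 3) =
        (32 * E₀) * ‖x‖ ^ 3 by ring, mul_div_cancel_right₀ _ hx3]
    calc |normalisedPressure w x| * (1 + ‖x‖) ^ 3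
        ≤ 4 * E₀ / (Real.pi * ‖x‖ ^ 3) * (8 * ‖x‖ ^ 3) :=
          mul_le_mul (hfar x hx'.le) h3 (pow_nonneg h1x.le 3) h4
      _ = 32 * E₀ / Real.pi := h5
      _ ≤ max (M * (1 + (2 * ρ + 2)) ^ 3) (32 * E₀ / Real.pi) := le_max_right _ _

/-- **`p̃[w] ∈ L^r(ℝ³)` for every `1 < r < ∞`** when `w ∈ C_c^∞(ℝ³; ℝ³)` (from the decay
`(1+|x|)^{-3} ∈ L^r` iff `3r > 3`; Ożański 2017, §1). [cite: Ozanski2017NSISingular, §1] -/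
theorem memLp_normalisedPressure_of_hasCompactSupport (hw : ContDiff ℝ ∞ w)
    (hwc : HasCompactSupport w) {r : ℝ} (hr : 1 < r) :
    MemLp (normalisedPressure w) (ENNReal.ofReal r) volume := by
  obtain ⟨C, hC0, hC⟩ := exists_abs_normalisedPressure_le_of_hasCompactSupport hw hwc
  have hr0 : 0 < r := by linarith
  have hmeas : AEStronglyMeasurable (normalisedPressure w) volume :=
    (continuous_normalisedPressure_of_hasCompactSupport hw hwc).aestronglyMeasurable
  set g : (EuclideanSpace ℝ (Fin 3)) → ℝ := fun x => C * (1 + ‖x‖) ^ (-(3 : ℝ)) with hg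
  have hg0 : ∀ x, 0 ≤ g x := fun x => mul_nonneg hC0 (Real.rpow_nonneg (by positivity) _)
  have hgm : AEStronglyMeasurable g volume := by
    refine Continuous.aestronglyMeasurable ?_
    refine continuous_const.mul (Continuous.rpow_const (by fun_prop) fun x => Or.inl ?_)
    positivity
  -- `g ∈ L^r`
  have hgint : Integrable (fun x => ‖g x‖ ^ (ENNReal.ofReal r).toReal) volume := by
    rw [ENNReal.toReal_ofReal hr0.le]
    have hdim : (Module.finrank ℝ (EuclideanSpace ℝ (Fin 3)) : ℝ) < 3 * r := by
      rw [finrank_euclideanSpace_fin]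
      push_cast
      linarith
    have hI := (integrable_one_add_norm (μ := (volume : Measure (EuclideanSpace ℝ (Fin 3)))) hdim).const_mul (C ^ r)
    refine hI.congr (Eventually.of_forall fun x => ?_)
    have h1x : 0 ≤ 1 + ‖x‖ := by positivity
    simp only [hg]
    rw [Real.norm_of_nonneg (hg0 x), Real.mul_rpow hC0 (Real.rpow_nonneg h1x _),
      ← Real.rpow_mul h1x]
    congr 2
    ring
  have hgLp : MemLp g (ENNReal.ofReal r) volume :=
    (integrable_norm_rpow_iff hgm (by simp [hr0]) ENNReal.ofReal_ne_top).1 hgint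
  refine hgLp.of_le hmeas (Eventually.of_forall fun x => ?_)
  rw [Real.norm_eq_abs, Real.norm_of_nonneg (hg0 x)]
  exact hC x

/-- In particular **`p̃[w] ∈ L^{3/2}(ℝ³)`**, the pressure class of weak solutions of the
Navier–Stokes inequality (Ożański 2020, Def. 1.1 / the tree's `IsPressureOf`).
[cite: Ozanski2019NSI, Def. 1.1] -/
theorem memLp_normalisedPressure_three_halves (hw : ContDiff ℝ ∞ w) (hwc : HasCompactSupport w) :
    MemLp (normalisedPressure w) (3 / 2 : ℝ≥0∞) volume := by
  have h := memLp_normalisedPressure_of_hasCompactSupport hw hwc (r := 3 / 2) (by norm_num)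
  have e : ENNReal.ofReal (3 / 2 : ℝ) = (3 / 2 : ℝ≥0∞) := by
    rw [ENNReal.ofReal_div_of_pos (by norm_num : (0 : ℝ) < 2)]
    norm_num
  rwa [e] at h

end CompactSupport

/-! ### Joint continuity of `(t, x) ↦ p̃[u(t)](x)` -/

section Joint

variable {S : Set ℝ} {u : ℝ → (EuclideanSpace ℝ (Fin 3)) → (EuclideanSpace ℝ (Fin 3))}
  {K : Set (EuclideanSpace ℝ (Fin 3))}

/-- The quadratic source `∂ᵢ∂ⱼ(vᵢvⱼ)` vanishes off the topological support of `v`. [folklore] -/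
theorem pressureSource_eq_zero_of_notMem_tsupport
    {v : (EuclideanSpace ℝ (Fin 3)) → (EuclideanSpace ℝ (Fin 3))} {x : (EuclideanSpace ℝ (Fin 3))}
    (hx : x ∉ tsupport v) : pressureSource v x = 0 := by
  rw [pressureSource_def]
  apply divergence_eq_zero_of_notMem_tsupport
  intro h
  apply hx
  refine (closure_minimal (fun y hy => ?_) (isClosed_tsupport v)) h
  by_contra hyv
  have hy0 : v y = 0 := image_eq_zero_of_notMem_tsupport hyv
  apply hy
  simp only [convect_apply, hy0, map_zero, smul_zero, add_zero]

/-- The far potential with cutoff radii `R₁ < R₂` vanishes near the support: if `v` is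
supported in `B̄(0, ρ)` and `|x| + ρ < R₁`, then `Q₂^{R₁,R₂}[v](x) = 0`. [folklore] -/
theorem farPotential_eq_zero_of_support
    {v : (EuclideanSpace ℝ (Fin 3)) → (EuclideanSpace ℝ (Fin 3))} {ρ R₁ R₂ : ℝ} (hR₁ : 0 ≤ R₁)
    (hR₁₂ : R₁ < R₂) (hv : ∀ y, v y ≠ 0 → ‖y‖ ≤ ρ) {x : (EuclideanSpace ℝ (Fin 3))} (hx : ‖x‖ + ρ < R₁) :
    farPotential R₁ R₂ v x = 0 := by
  rw [farPotential]
  refine integral_eq_zero_of_ae (Eventually.of_forall fun y => ?_)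
  by_cases hy : v y = 0
  · simp [hy]
  · have h1 : ‖x - y‖ < R₁ := by
      calc ‖x - y‖ ≤ ‖x‖ + ‖y‖ := norm_sub_le _ _
        _ ≤ ‖x‖ + ρ := by linarith [hv y hy]
        _ < R₁ := hx
    simp only [Pi.zero_apply]
    rw [fderiv2_newtonFar_eq_zero hR₁ hR₁₂ h1]
    simp

/-- **Joint continuity of the pressure function along a smooth compactly supported flow.**
Let `u` be jointly `C^∞` on `S × ℝ³` (`S` of unique differentiability, e.g. an interval) with
`u(t, x) = 0` for `x` outside a fixed compact set `K`, for all `t ∈ S`. Then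
`(t, x) ↦ p̃[u(t)](x)` is continuous on `S × ℝ³`: locally in `x` and at a large cutoff scale
`R`, `p̃[u(t)] = -(Γ₀^{R,2R} ∗ ∂ᵢ∂ⱼ(uᵢuⱼ)(t))`, the convolution of an `L¹_loc` kernel with a
jointly continuous source supported in `K` (Mathlib `continuousOn_convolution_right_with_param`).
[folklore] -/
theorem continuousOn_normalisedPressure_slice (hu : IsSmoothSpaceTimeOn S u)
    (hS : UniqueDiffOn ℝ S) (hK : IsCompact K) (h0 : ∀ t ∈ S, ∀ x ∉ K, u t x = 0) :
    ContinuousOn (fun z : ℝ × (EuclideanSpace ℝ (Fin 3)) => normalisedPressure (u z.1) z.2) (S ×ˢ univ) := by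
  -- radius of the common support
  obtain ⟨ρ, hρ0, hρ⟩ : ∃ ρ : ℝ, 0 < ρ ∧ ∀ y ∈ K, ‖y‖ ≤ ρ := hK.isBounded.exists_pos_norm_le
  have hsupp : ∀ t ∈ S, ∀ y, u t y ≠ 0 → ‖y‖ ≤ ρ := fun t ht y hy =>
    hρ y (by by_contra h; exact hy (h0 t ht y h))
  have htsupp : ∀ t ∈ S, tsupport (u t) ⊆ K := fun t ht =>
    closure_minimal (fun y hy => by by_contra h; exact hy (h0 t ht y h)) hK.isClosed
  have hslice : ∀ t ∈ S, ContDiff ℝ ∞ (u t) := fun t ht => hu.contDiff_slice ht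
  have hcs : ∀ t ∈ S, HasCompactSupport (u t) := fun t ht =>
    hK.of_isClosed_subset (isClosed_tsupport _) (htsupp t ht)
  -- the jointly continuous source, supported in `K`
  set g : ℝ → (EuclideanSpace ℝ (Fin 3)) → ℝ := fun t y => pressureSource (u t) y with hg
  have hgc : ContinuousOn (↿g) (S ×ˢ univ) := (hu.pressureSource hS).continuousOn
  have hgs : ∀ t, ∀ x, t ∈ S → x ∉ K → g t x = 0 := fun t x ht hx =>
    pressureSource_eq_zero_of_notMem_tsupport fun h => hx (htsupp t ht h)
  -- continuity at each point
  rintro ⟨t₀, x₀⟩ ⟨ht₀, -⟩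
  set R : ℝ := ‖x₀‖ + 1 + ρ + 1 with hR
  have hRpos : 0 < R := by positivity
  have hR12 : R * 1 < R * 2 := by linarith
  have hconv := continuousOn_convolution_right_with_param (ContinuousLinearMap.mul ℝ ℝ) hK hgs
    ((integrable_newtonNear (by positivity : (0 : ℝ) ≤ R * 1) hR12).locallyIntegrable)
    hgc (μ := volume)
  -- the local representation `p̃ = -(Γ₀ ⋆ g)` on `S × B(x₀, 1)`
  have hrep : ∀ z : ℝ × (EuclideanSpace ℝ (Fin 3)), z ∈ S ×ˢ ball x₀ 1 →
      normalisedPressure (u z.1) z.2 = -((newtonNear (R * 1) (R * 2) ⋆[ContinuousLinearMap.mul ℝ ℝ,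
        volume] g z.1) z.2) := by
    rintro ⟨t, x⟩ ⟨ht, hx⟩
    have hL2 := integrable_norm_sq_of_hasCompactSupport (hslice t ht).continuous (hcs t ht)
    simp only
    have hx' : ‖x‖ + ρ < R * 1 := by
      rw [mem_ball, dist_eq_norm] at hx
      have : ‖x‖ ≤ ‖x - x₀‖ + ‖x₀‖ := by
        calc ‖x‖ = ‖x - x₀ + x₀‖ := by rw [sub_add_cancel]
          _ ≤ ‖x - x₀‖ + ‖x₀‖ := norm_add_le _ _
      rw [hR]
      linarith
    rw [normalisedPressure_eq_pressurePotential_of_hasCompactSupport (hslice t ht) (hcs t ht),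
      pressurePotential_eq_scale hRpos (contDiff_infty.1 (hslice t ht) 2) hL2,
      farPotential_eq_zero_of_support (by positivity) hR12 (hsupp t ht) hx', sub_zero,
      convolution_mul]
    simp only [nearPotential, hg]
  have hmem : (S ×ˢ ball x₀ 1 : Set (ℝ × (EuclideanSpace ℝ (Fin 3)))) ∈ 𝓝[S ×ˢ univ] (t₀, x₀) := by
    rw [nhdsWithin_prod_eq, nhdsWithin_univ]
    exact prod_mem_prod self_mem_nhdsWithin (ball_mem_nhds x₀ one_pos)
  have hev : (fun z : ℝ × (EuclideanSpace ℝ (Fin 3)) => normalisedPressure (u z.1) z.2) =ᶠ[𝓝[S ×ˢ univ] (t₀, x₀)]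
      fun z => -((newtonNear (R * 1) (R * 2) ⋆[ContinuousLinearMap.mul ℝ ℝ, volume] g z.1) z.2) :=
    eventually_of_mem hmem hrep
  refine (hev.congr_continuousWithinAt_of_mem ⟨ht₀, mem_univ _⟩).2 ?_
  exact (hconv (t₀, x₀) ⟨ht₀, mem_univ _⟩).neg

end Joint

end Literature.Analysis.FluidPDE

end
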